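import Mathlib
import HarnessLib

/-!
# Bathtub principle with a variable cap

Stub `stub_bathtub` for the line *parity–multiplicity–commutator* of the crux
`GroundStateSimpleEven` (Weil ground state): the bathtub principle (Lieb–Loss, *Analysis*,
Thm. 1.14) with a variable cap `F` on `S = [-R, R]` and a weight `m` that is non-decreasing in
`|t|`. Among densities `0 ≤ f ≤ F` whose total mass dominates `∫_S F`, the weighted mass `∫ f m`
is at least `∫_S F m`: on `S` one has `(F − f) m ≤ (F − f) m(R)`, off `S` one has
`f m ≥ f m(R)`, and adding up, `∫ f m ≥ ∫_S F m + m(R) (∫ f − ∫_S F) ≥ ∫_S F m`.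
-/

open Set MeasureTheory Filter

open scoped Real Topology

namespace Summit.RiemannHypothesis.RiemannHypothesis.Theorems

set_option linter.dupNamespace false in
/-- **Bathtub principle with a variable cap** (Lieb–Loss, Thm. 1.14): if `0 ≤ f ≤ F`, the weight
`m` is non-decreasing in `|t|` with `0 ≤ m R`, and `∫_{[-R,R]} F ≤ ∫ f`, then
`∫_{[-R,R]} F m ≤ ∫ f m`. On `S = [-R, R]`, `F m − m(R)(F − f) ≤ f m`; on `Sᶜ`, `m(R) f ≤ f m`;
add the two integrated inequalities and use the mass hypothesis. [folklore] -/
theorem stub_bathtub :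
    ∀ (f F m : ℝ → ℝ) (R : ℝ), 0 ≤ R → (∀ t, 0 ≤ f t) → (∀ t, f t ≤ F t) →
      (∀ s t, |s| ≤ |t| → m s ≤ m t) → 0 ≤ m R →
      Integrable f → Integrable (fun t ↦ f t * m t) →
      IntegrableOn F (Icc (-R) R) → IntegrableOn (fun t ↦ F t * m t) (Icc (-R) R) →
      ∫ t in Icc (-R) R, F t ≤ ∫ t, f t →
        ∫ t in Icc (-R) R, F t * m t ≤ ∫ t, f t * m t := by
  intro f F m R hR hf0 hfF hm hmR hfi hfmi hFi hFmi hmass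
  set S : Set ℝ := Icc (-R) R
  have hS : MeasurableSet S := measurableSet_Icc
  -- split `∫ f` and `∫ f m` along `S ∪ Sᶜ`
  have hsplit_f : ∫ t, f t = (∫ t in S, f t) + ∫ t in Sᶜ, f t :=
    (integral_add_compl hS hfi).symm
  have hsplit_fm : ∫ t, f t * m t = (∫ t in S, f t * m t) + ∫ t in Sᶜ, f t * m t :=
    (integral_add_compl hS hfmi).symm
  -- on `S`, `m t ≤ m R`; on `Sᶜ`, `m R ≤ m t`
  have hmS : ∀ t ∈ S, m t ≤ m R := by
    intro t ht
    refine hm t R ?_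
    rw [abs_of_nonneg hR]
    exact abs_le.mpr ht
  have hmSc : ∀ t ∈ Sᶜ, m R ≤ m t := by
    intro t ht
    refine hm R t ?_
    rw [abs_of_nonneg hR]
    have h : ¬ (|t| ≤ R) := fun h ↦ ht (abs_le.mp h)
    exact (not_le.mp h).le
  -- the piece `S`
  have hIi : IntegrableOn (fun t ↦ m R * (F t - f t)) S := (hFi.sub hfi.integrableOn).const_mul _
  have h1 : ∫ t in S, (F t * m t - m R * (F t - f t)) ≤ ∫ t in S, f t * m t := by
    refine setIntegral_mono_on (hFmi.sub hIi) hfmi.integrableOn hS fun t ht ↦ ?_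
    have h2 : 0 ≤ F t - f t := sub_nonneg.mpr (hfF t)
    nlinarith [mul_le_mul_of_nonneg_left (hmS t ht) h2]
  have h1' : ∫ t in S, (F t * m t - m R * (F t - f t)) =
      (∫ t in S, F t * m t) - m R * ((∫ t in S, F t) - ∫ t in S, f t) := by
    rw [integral_sub hFmi hIi, integral_const_mul, integral_sub hFi hfi.integrableOn]
  -- the piece `Sᶜ`
  have h2 : ∫ t in Sᶜ, m R * f t ≤ ∫ t in Sᶜ, f t * m t := by
    refine setIntegral_mono_on (hfi.integrableOn.const_mul _) hfmi.integrableOn hS.compl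
      fun t ht ↦ ?_
    nlinarith [mul_le_mul_of_nonneg_left (hmSc t ht) (hf0 t)]
  have h2' : ∫ t in Sᶜ, m R * f t = m R * ∫ t in Sᶜ, f t := integral_const_mul _ _
  -- combine
  rw [h1'] at h1
  rw [h2'] at h2
  have hmass' : (∫ t in S, F t) ≤ (∫ t in S, f t) + ∫ t in Sᶜ, f t := hsplit_f ▸ hmass
  rw [hsplit_fm]
  nlinarith [mul_le_mul_of_nonneg_left hmass' hmR]

end Summit.RiemannHypothesis.RiemannHypothesis.Theorems
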